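import Mathlib
import Summits.ValiantsHypothesis.ValiantsHypothesis.Theorems.NewtonUnitEquationsDissociatedUniformStubExposedGenericDirection
import Summits.ValiantsHypothesis.ValiantsHypothesis.Theorems.NewtonUnitEquationsNewtonTauWeakSignvecCount
import Summits.ValiantsHypothesis.ValiantsHypothesis.Theorems.NewtonUnitEquationsNewtonTauWeakMarkedSwitchNormalForm
import Summits.ValiantsHypothesis.ValiantsHypothesis.Theorems.NewtonUnitEquationsNewtonTauWeakResidueDesignHull

/-!
# `NewtonUnitEquationsNewtonTauWeakMarkedDesignHull` — THEOREM G′: hull vertices of marked residue level sets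

Registered stub `stub_markedDesignHull` of line `binomial-normal-form` (crux `NewtonTauWeak`,
stmt-ValiantsHypothesis-5904, lead c5): the assembly of THEOREM G′ (the t-nomial / crux-language analogue of
THEOREM G, `stub_residueDesignHull`) from its landed pieces.

Setting.  Factors `j : Fin m` carry letter sets `A j ⊆ ℕ²` with `|A j| ≤ L` and `0/1` marks `μ j`; a word
`a ∈ Π_j A j` is *admissible* if `Σ_j μ j (a j) ≡ r (mod q)` (`q ≥ 1`), and `X = {Σ_j a j : a admissible} ⊆ ℕ²`.
Claim: the convex hull of `X ⊆ ℝ²` has at most `(4 ((m L)² + (m L)⁴) + 5) q²` extreme points — polynomially many,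
uniformly in the number `q` of residue classes.

Proof.
* (`MarkedDesignHullAux.extremePoint_normalForm`)  An extreme point `e` of `conv X` is strictly exposed by a direction
  `w` whose height `c = ⟨w, ·⟩` is injective on the set `Λ` of all letters
  (`NewtonUnitEquationsDissociatedUniform.stub_exposedGenericDirection`), and `e = Σ_j a₀ j` for an admissible word `a₀`
  maximising `Σ_j c (a j)` over admissible words (heights are additive); by the switch normal form
  `stub_markedSwitchNormalForm` (piece G6) and strict exposure, `e = Σ_j a j` for an admissible word `a` of SPECIAL FORM
  with switch set `S` and switch counts `n₀, n₁ < q`.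
* (`MarkedDesignHullAux.word_eq`)  For fixed heights a special-form word is determined by its two switch counts: off the
  switch set the letter is the top letter, on it the best letter of the opposite mark (`letter_eq_of_spec`), and two
  switch sets with the same counts coincide, both being down-sets of the switchable factors of either type for the loss
  key (`switchSet_subset`).  The special form only involves the comparisons `c x - c y ⋚ c x' - c y'`
  (`x, y, x', y' ∈ Λ`), i.e. the signs of the `|Λ|⁴` linear functionals `w ↦ ⟨w, (x - y) - (x' - y')⟩` at `w`
  (`MarkedDesignHullAux.specs_transfer`).
* (`stub_markedDesignHull`)  Hence `e ↦ (sign vector of w, n₀, n₁)` is injective on the extreme points, with values in a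
  set of size `≤ (4 |Λ|⁴ + 5) q²` (`ResidueDesignHullAux.signvec_plane_count`, from piece G1), and `|Λ| ≤ m L`.

Everything is folklore (planar convexity, exchange argument, arrangements on a line); no named facts, no citations.
No `def`s: the sign-vector datum is an explicit lambda term.
-/

-- Sub = Summit single-conjunct layout: the duplicated namespace component is mandated by the tree.
set_option linter.dupNamespace false

noncomputable section

open scoped BigOperators

namespace Summit.ValiantsHypothesis.ValiantsHypothesis.Theorems.NewtonUnitEquationsNewtonTauWeak

namespace MarkedDesignHullAux

variable {K : Type*}

/-- **A switched letter is pinned.**  In a factor with letters `T`, `0/1` marks `μ` and heights `c` injective on `T`, a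
letter which is the highest of its own mark while the top letter has the other mark is unique: the top letter is unique,
so the mark is pinned, so the letter is. [folklore] -/
theorem letter_eq_of_spec (T : Finset K) (μ : K → ℕ) (hμ : ∀ x, μ x ≤ 1) (c : K → ℝ)
    (hc : Set.InjOn c (T : Set K)) {b b' : K} (hb : b ∈ T) (hb' : b' ∈ T)
    (h : (∀ y ∈ T, μ y = μ b → c y ≤ c b) ∧ ∃ x ∈ T, μ x ≠ μ b ∧ ∀ y ∈ T, c y ≤ c x)
    (h' : (∀ y ∈ T, μ y = μ b' → c y ≤ c b') ∧ ∃ x ∈ T, μ x ≠ μ b' ∧ ∀ y ∈ T, c y ≤ c x) : b = b' := by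
  obtain ⟨hb1, x, hx, hxb, hxmax⟩ := h
  obtain ⟨hb1', x', hx', hxb', hxmax'⟩ := h'
  obtain rfl : x = x' := hc hx hx' (le_antisymm (hxmax' x hx) (hxmax x' hx'))
  have hμb : μ b = μ b' := by have := hμ b; have := hμ b'; have := hμ x; omega
  exact hc hb hb' (le_antisymm (hb1' b hb hμb) (hb1 b' hb' hμb.symm))

/-- **Switch sets with equal counts are nested.**  Let two words `a, a'` be in the special form of
`stub_markedSwitchNormalForm` (same factors `A`, marks `μ`, heights `c` injective on each factor) with switch sets
`S, S'` having the same number of switched factors of either mark.  Then `S ⊆ S'`: for `z ∈ S \ S'` the equal counts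
give a `z' ∈ S' \ S` of the same type, and the down-set clauses of the two normal forms give both
`(loss z, z) <lex (loss z', z')` and `(loss z', z') <lex (loss z, z)`. [folklore] -/
theorem switchSet_subset {m : ℕ} (A : Fin m → Finset K) (μ : Fin m → K → ℕ) (hμ : ∀ j x, μ j x ≤ 1)
    (c : K → ℝ) (hc : ∀ j, Set.InjOn c (A j : Set K)) (a a' : Fin m → K) (S S' : Finset (Fin m))
    (h1 : ∀ j, a j ∈ A j) (h4 : ∀ j, j ∉ S → ∀ x ∈ A j, c x ≤ c (a j))
    (h5 : ∀ j ∈ S, (∀ y ∈ A j, μ j y = μ j (a j) → c y ≤ c (a j)) ∧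
      ∃ x ∈ A j, μ j x ≠ μ j (a j) ∧ ∀ y ∈ A j, c y ≤ c x)
    (h8 : ∀ j ∈ S, ∀ j', j' ∉ S → (∀ y ∈ A j', c y ≤ c (a j')) → μ j' (a j') ≠ μ j (a j) →
      ∀ x ∈ A j, (∀ y ∈ A j, c y ≤ c x) →
      ∀ x' ∈ A j', μ j' x' ≠ μ j' (a j') → (∀ y' ∈ A j', μ j' y' ≠ μ j' (a j') → c y' ≤ c x') →
        (c x - c (a j) < c (a j') - c x' ∨ (c x - c (a j) = c (a j') - c x' ∧ j < j')))
    (h1' : ∀ j, a' j ∈ A j) (h4' : ∀ j, j ∉ S' → ∀ x ∈ A j, c x ≤ c (a' j))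
    (h5' : ∀ j ∈ S', (∀ y ∈ A j, μ j y = μ j (a' j) → c y ≤ c (a' j)) ∧
      ∃ x ∈ A j, μ j x ≠ μ j (a' j) ∧ ∀ y ∈ A j, c y ≤ c x)
    (h8' : ∀ j ∈ S', ∀ j', j' ∉ S' → (∀ y ∈ A j', c y ≤ c (a' j')) → μ j' (a' j') ≠ μ j (a' j) →
      ∀ x ∈ A j, (∀ y ∈ A j, c y ≤ c x) →
      ∀ x' ∈ A j', μ j' x' ≠ μ j' (a' j') → (∀ y' ∈ A j', μ j' y' ≠ μ j' (a' j') → c y' ≤ c x') →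
        (c x - c (a' j) < c (a' j') - c x' ∨ (c x - c (a' j) = c (a' j') - c x' ∧ j < j')))
    (hn : ∀ ν, ν ≤ 1 →
      (S.filter fun j => μ j (a j) = ν).card = (S'.filter fun j => μ j (a' j) = ν).card) :
    S ⊆ S' := by
  intro z hz
  by_contra hz'
  -- on `S` the word `a` takes the best letter of its mark, and the top letter `a' z` (as `z ∉ S'`) has the other mark
  obtain ⟨h5a, x, hx, hxν, hxmax⟩ := h5 z hz
  obtain rfl : x = a' z := hc z hx (h1' z) (le_antisymm (h4' z hz' x hx) (hxmax _ (h1' z)))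
  -- a factor `z' ∈ S'` switched by `a'` to the same mark and not so counted for `a`, by the equal counts
  obtain ⟨z', hz'F', hz'F⟩ : ∃ z' ∈ S'.filter (fun j => μ j (a' j) = μ z (a z)),
      z' ∉ S.filter fun j => μ j (a j) = μ z (a z) := by
    refine Finset.not_subset.1 fun hsub => hz' ?_
    have hFF := Finset.eq_of_subset_of_card_le hsub (hn _ (hμ z (a z))).le
    have hzF : z ∈ S.filter fun j => μ j (a j) = μ z (a z) := Finset.mem_filter.2 ⟨hz, rfl⟩
    rw [← hFF] at hzF
    exact (Finset.mem_filter.1 hzF).1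
  obtain ⟨hz'S', hz'ν⟩ := Finset.mem_filter.1 hz'F'
  obtain ⟨h5a', x', hx', hx'ν, hx'max⟩ := h5' z' hz'S'
  -- `z' ∉ S`: else the switched letters `a z'`, `a' z'` coincide (pinned) and `z'` is counted for `a` as well
  have hz'S : z' ∉ S := fun hz'S => hz'F (Finset.mem_filter.2 ⟨hz'S, by
    rw [letter_eq_of_spec (A z') (μ z') (hμ z') c (hc z') (h1 z') (h1' z') (h5 z' hz'S) (h5' z' hz'S')]
    exact hz'ν⟩)
  -- so `a z'` is the top letter of `A z'`
  obtain rfl : x' = a z' := hc z' hx' (h1 z') (le_antisymm (h4 z' hz'S x' hx') (hx'max _ (h1 z')))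
  -- the two down-set clauses contradict each other
  have H := h8 z hz z' hz'S (h4 z' hz'S) (by rw [← hz'ν]; exact hx'ν) (a' z) hx hxmax (a' z') (h1' z')
    hx'ν.symm fun y hy hne => h5a' y hy (by
      have := hμ z' y; have := hμ z' (a' z'); have := hμ z' (a z'); omega)
  have H' := h8' z' hz'S' z hz' (h4' z hz') (by rw [hz'ν]; exact hxν) (a z') (h1 z') (h4 z' hz'S) (a z) (h1 z)
    hxν.symm fun y hy hne => h5a y hy (by
      have := hμ z y; have := hμ z (a z); have := hμ z (a' z); omega)
  rcases H with H | ⟨H, hzz⟩ <;> rcases H' with H' | ⟨H', hzz'⟩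
  · exact lt_asymm H H'
  · exact H.ne H'.symm
  · exact H'.ne H.symm
  · exact lt_asymm hzz hzz'

/-- **A special-form word is determined by its switch counts** (for fixed heights): two words in the special form of
`stub_markedSwitchNormalForm` for the same factors, marks and heights with the same numbers of switched factors of
mark `0` and of mark `1` coincide — their switch sets coincide (`switchSet_subset` twice) and every letter is pinned
(the top letter off the switch set, `letter_eq_of_spec` on it). [folklore] -/
theorem word_eq {m : ℕ} (A : Fin m → Finset K) (μ : Fin m → K → ℕ) (hμ : ∀ j x, μ j x ≤ 1)
    (c : K → ℝ) (hc : ∀ j, Set.InjOn c (A j : Set K)) (a a' : Fin m → K) (S S' : Finset (Fin m))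
    (h1 : ∀ j, a j ∈ A j) (h4 : ∀ j, j ∉ S → ∀ x ∈ A j, c x ≤ c (a j))
    (h5 : ∀ j ∈ S, (∀ y ∈ A j, μ j y = μ j (a j) → c y ≤ c (a j)) ∧
      ∃ x ∈ A j, μ j x ≠ μ j (a j) ∧ ∀ y ∈ A j, c y ≤ c x)
    (h8 : ∀ j ∈ S, ∀ j', j' ∉ S → (∀ y ∈ A j', c y ≤ c (a j')) → μ j' (a j') ≠ μ j (a j) →
      ∀ x ∈ A j, (∀ y ∈ A j, c y ≤ c x) →
      ∀ x' ∈ A j', μ j' x' ≠ μ j' (a j') → (∀ y' ∈ A j', μ j' y' ≠ μ j' (a j') → c y' ≤ c x') →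
        (c x - c (a j) < c (a j') - c x' ∨ (c x - c (a j) = c (a j') - c x' ∧ j < j')))
    (h1' : ∀ j, a' j ∈ A j) (h4' : ∀ j, j ∉ S' → ∀ x ∈ A j, c x ≤ c (a' j))
    (h5' : ∀ j ∈ S', (∀ y ∈ A j, μ j y = μ j (a' j) → c y ≤ c (a' j)) ∧
      ∃ x ∈ A j, μ j x ≠ μ j (a' j) ∧ ∀ y ∈ A j, c y ≤ c x)
    (h8' : ∀ j ∈ S', ∀ j', j' ∉ S' → (∀ y ∈ A j', c y ≤ c (a' j')) → μ j' (a' j') ≠ μ j (a' j) →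
      ∀ x ∈ A j, (∀ y ∈ A j, c y ≤ c x) →
      ∀ x' ∈ A j', μ j' x' ≠ μ j' (a' j') → (∀ y' ∈ A j', μ j' y' ≠ μ j' (a' j') → c y' ≤ c x') →
        (c x - c (a' j) < c (a' j') - c x' ∨ (c x - c (a' j) = c (a' j') - c x' ∧ j < j')))
    (hn0 : (S.filter fun j => μ j (a j) = 0).card = (S'.filter fun j => μ j (a' j) = 0).card)
    (hn1 : (S.filter fun j => μ j (a j) = 1).card = (S'.filter fun j => μ j (a' j) = 1).card) :
    a = a' := by
  have hn : ∀ ν, ν ≤ 1 →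
      (S.filter fun j => μ j (a j) = ν).card = (S'.filter fun j => μ j (a' j) = ν).card := fun ν hν => by
    rcases Nat.le_one_iff_eq_zero_or_eq_one.1 hν with rfl | rfl
    exacts [hn0, hn1]
  obtain rfl : S = S' :=
    Finset.Subset.antisymm (switchSet_subset A μ hμ c hc a a' S S' h1 h4 h5 h8 h1' h4' h5' h8' hn)
      (switchSet_subset A μ hμ c hc a' a S' S h1' h4' h5' h8' h1 h4 h5 h8 fun ν hν => (hn ν hν).symm)
  funext j
  by_cases hj : j ∈ S
  · exact letter_eq_of_spec (A j) (μ j) (hμ j) c (hc j) (h1 j) (h1' j) (h5 j hj) (h5' j hj)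
  · exact hc j (h1 j) (h1' j) (le_antisymm (h4' j hj _ (h1 j)) (h4 j hj _ (h1' j)))

/-- **The special form only sees signs of differences of height differences.**  If two height functions `c, c'` give
the same sign to `(c x - c y) - (c x' - c y')` for all letters `x, y, x', y' ∈ Λ ⊇ ⋃ A j` (in particular they order
every factor alike), then a word in special form for `c'` is in special form for `c`. [folklore] -/
theorem specs_transfer {m : ℕ} (A : Fin m → Finset K) (Λ : Finset K) (hAΛ : ∀ j, ∀ x ∈ A j, x ∈ Λ)
    (μ : Fin m → K → ℕ) (c c' : K → ℝ)
    (hcmp : ∀ x ∈ Λ, ∀ y ∈ Λ, ∀ x' ∈ Λ, ∀ y' ∈ Λ,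
      SignType.sign (c x - c y - (c x' - c y')) = SignType.sign (c' x - c' y - (c' x' - c' y')))
    (a : Fin m → K) (S : Finset (Fin m)) (h1 : ∀ j, a j ∈ A j)
    (h4 : ∀ j, j ∉ S → ∀ x ∈ A j, c' x ≤ c' (a j))
    (h5 : ∀ j ∈ S, (∀ y ∈ A j, μ j y = μ j (a j) → c' y ≤ c' (a j)) ∧
      ∃ x ∈ A j, μ j x ≠ μ j (a j) ∧ ∀ y ∈ A j, c' y ≤ c' x)
    (h8 : ∀ j ∈ S, ∀ j', j' ∉ S → (∀ y ∈ A j', c' y ≤ c' (a j')) → μ j' (a j') ≠ μ j (a j) →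
      ∀ x ∈ A j, (∀ y ∈ A j, c' y ≤ c' x) →
      ∀ x' ∈ A j', μ j' x' ≠ μ j' (a j') → (∀ y' ∈ A j', μ j' y' ≠ μ j' (a j') → c' y' ≤ c' x') →
        (c' x - c' (a j) < c' (a j') - c' x' ∨ (c' x - c' (a j) = c' (a j') - c' x' ∧ j < j'))) :
    (∀ j, j ∉ S → ∀ x ∈ A j, c x ≤ c (a j)) ∧
    (∀ j ∈ S, (∀ y ∈ A j, μ j y = μ j (a j) → c y ≤ c (a j)) ∧
      ∃ x ∈ A j, μ j x ≠ μ j (a j) ∧ ∀ y ∈ A j, c y ≤ c x) ∧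
    (∀ j ∈ S, ∀ j', j' ∉ S → (∀ y ∈ A j', c y ≤ c (a j')) → μ j' (a j') ≠ μ j (a j) →
      ∀ x ∈ A j, (∀ y ∈ A j, c y ≤ c x) →
      ∀ x' ∈ A j', μ j' x' ≠ μ j' (a j') → (∀ y' ∈ A j', μ j' y' ≠ μ j' (a j') → c y' ≤ c x') →
        (c x - c (a j) < c (a j') - c x' ∨ (c x - c (a j) = c (a j') - c x' ∧ j < j'))) := by
  have hlt : ∀ x ∈ Λ, ∀ y ∈ Λ, ∀ x' ∈ Λ, ∀ y' ∈ Λ,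
      (c x - c y < c x' - c y' ↔ c' x - c' y < c' x' - c' y') := fun x hx y hy x' hx' y' hy' => by
    rw [← sub_neg, ← sign_eq_neg_one_iff, hcmp x hx y hy x' hx' y' hy', sign_eq_neg_one_iff, sub_neg]
  have heq : ∀ x ∈ Λ, ∀ y ∈ Λ, ∀ x' ∈ Λ, ∀ y' ∈ Λ,
      (c x - c y = c x' - c y' ↔ c' x - c' y = c' x' - c' y') := fun x hx y hy x' hx' y' hy' => by
    rw [← sub_eq_zero, ← sign_eq_zero_iff, hcmp x hx y hy x' hx' y' hy', sign_eq_zero_iff, sub_eq_zero]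
  have hle : ∀ x ∈ Λ, ∀ y ∈ Λ, (c y ≤ c x ↔ c' y ≤ c' x) := fun x hx y hy => by
    have h := hlt x hx y hy x hx x hx
    rw [sub_self, sub_self, sub_neg, sub_neg] at h
    rw [← not_lt, h, not_lt]
  refine ⟨fun j hj x hx => (hle _ (hAΛ j _ (h1 j)) x (hAΛ j x hx)).2 (h4 j hj x hx), fun j hj => ?_, ?_⟩
  · obtain ⟨h5a, x, hx, hxne, hxmax⟩ := h5 j hj
    exact ⟨fun y hy hμy => (hle _ (hAΛ j _ (h1 j)) y (hAΛ j y hy)).2 (h5a y hy hμy), x, hx, hxne,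
      fun y hy => (hle x (hAΛ j x hx) y (hAΛ j y hy)).2 (hxmax y hy)⟩
  · intro j hj j' hj' H1 H2 x hx H3 x' hx' H4 H5
    have key := h8 j hj j' hj' (fun y hy => (hle _ (hAΛ j' _ (h1 j')) y (hAΛ j' y hy)).1 (H1 y hy)) H2 x hx
      (fun y hy => (hle x (hAΛ j x hx) y (hAΛ j y hy)).1 (H3 y hy)) x' hx' H4
      fun y' hy' hne => (hle x' (hAΛ j' x' hx') y' (hAΛ j' y' hy')).1 (H5 y' hy' hne)
    rcases key with k | ⟨k, k'⟩
    · exact Or.inl ((hlt x (hAΛ j x hx) _ (hAΛ j _ (h1 j)) _ (hAΛ j' _ (h1 j')) x' (hAΛ j' x' hx')).2 k)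
    · exact Or.inr ⟨(heq x (hAΛ j x hx) _ (hAΛ j _ (h1 j)) _ (hAΛ j' _ (h1 j')) x' (hAΛ j' x' hx')).2 k, k'⟩

/-- **Every vertex is the point of a special-form word.**  Every extreme point `e` of the convex hull of
`X = {Σ_j a j : a admissible}` is `Σ_j a j` for a word `a` in the special form of `stub_markedSwitchNormalForm` with
respect to the height `c = ⟨w, ·⟩` of a strictly exposing direction `w` generic for the set `Λ` of all letters
(`stub_exposedGenericDirection`): `e = Σ_j a₀ j` with `a₀` admissible maximising `Σ_j c (a j)` over admissible words
(heights of sums are sums of heights), the special-form word is admissible of the same value, and a strictly exposed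
maximum is attained at `e` only. [folklore] -/
theorem extremePoint_normalForm (m q r : ℕ) (hq : 1 ≤ q) (A : Fin m → Finset (Fin 2 →₀ ℕ))
    (μ : Fin m → (Fin 2 →₀ ℕ) → ℕ) (hμ : ∀ j a, μ j a ≤ 1) (Λ : Finset (Fin 2 →₀ ℕ))
    (hAΛ : ∀ j, ∀ x ∈ A j, x ∈ Λ) (e : Fin 2 → ℝ)
    (he : e ∈ Set.extremePoints ℝ (convexHull ℝ ((fun e : Fin 2 →₀ ℕ => fun i : Fin 2 => ((e i : ℕ) : ℝ)) ''
      (((Fintype.piFinset A).filter (fun a : Fin m → (Fin 2 →₀ ℕ) => (∑ j, μ j (a j)) % q = r % q)).image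
        (fun a => ∑ j, a j) : Set (Fin 2 →₀ ℕ))))) :
    ∃ (w : Fin 2 → ℝ) (c : (Fin 2 →₀ ℕ) → ℝ) (a : Fin m → (Fin 2 →₀ ℕ)) (S : Finset (Fin m)),
      (∀ x, c x = ∑ i, w i * ((x i : ℕ) : ℝ)) ∧ Set.InjOn c (Λ : Set (Fin 2 →₀ ℕ)) ∧
      (∀ j, a j ∈ A j) ∧
      (∀ j, j ∉ S → ∀ x ∈ A j, c x ≤ c (a j)) ∧
      (∀ j ∈ S, (∀ y ∈ A j, μ j y = μ j (a j) → c y ≤ c (a j)) ∧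
        ∃ x ∈ A j, μ j x ≠ μ j (a j) ∧ ∀ y ∈ A j, c y ≤ c x) ∧
      (S.filter fun j => μ j (a j) = 0).card < q ∧ (S.filter fun j => μ j (a j) = 1).card < q ∧
      (∀ j ∈ S, ∀ j', j' ∉ S → (∀ y ∈ A j', c y ≤ c (a j')) →
        μ j' (a j') ≠ μ j (a j) →
        ∀ x ∈ A j, (∀ y ∈ A j, c y ≤ c x) →
        ∀ x' ∈ A j', μ j' x' ≠ μ j' (a j') → (∀ y' ∈ A j', μ j' y' ≠ μ j' (a j') → c y' ≤ c x') →
          (c x - c (a j) < c (a j') - c x' ∨ (c x - c (a j) = c (a j') - c x' ∧ j < j'))) ∧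
      e = fun i => (((∑ j, a j) i : ℕ) : ℝ) := by
  obtain ⟨w, e₀, he₀X, rfl, hexp, hinjΛ⟩ :=
    NewtonUnitEquationsDissociatedUniform.stub_exposedGenericDirection _ Λ e he
  obtain ⟨c, hc⟩ : ∃ c : (Fin 2 →₀ ℕ) → ℝ, ∀ x, c x = ∑ i, w i * ((x i : ℕ) : ℝ) := ⟨_, fun _ => rfl⟩
  have hcΛ : Set.InjOn c (Λ : Set (Fin 2 →₀ ℕ)) := fun x hx y hy hxy => by
    rw [hc, hc] at hxy
    exact hinjΛ hx hy hxy
  -- heights of sums are sums of heights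
  have hlin : ∀ a : Fin m → (Fin 2 →₀ ℕ), c (∑ j, a j) = ∑ j, c (a j) := by
    intro a
    simp only [hc, Finsupp.finsetSum_apply, Nat.cast_sum, Finset.mul_sum]
    exact Finset.sum_comm
  -- admissible words give points of `X`
  have hmem : ∀ a : Fin m → (Fin 2 →₀ ℕ), (∀ j, a j ∈ A j) → (∑ j, μ j (a j)) % q = r % q →
      ∑ j, a j ∈ ((Fintype.piFinset A).filter fun a : Fin m → (Fin 2 →₀ ℕ) =>
        (∑ j, μ j (a j)) % q = r % q).image fun a => ∑ j, a j :=
    fun a ha hadm => Finset.mem_image.2 ⟨a, Finset.mem_filter.2 ⟨Fintype.mem_piFinset.2 ha, hadm⟩, rfl⟩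
  -- the exposed vertex is the point of an admissible word of maximal height
  obtain ⟨a₀, ha₀, rfl⟩ := Finset.mem_image.1 he₀X
  obtain ⟨ha₀A, hadm⟩ := Finset.mem_filter.1 ha₀
  have ha₀A' : ∀ j, a₀ j ∈ A j := Fintype.mem_piFinset.1 ha₀A
  have hmax : ∀ a : Fin m → (Fin 2 →₀ ℕ), (∀ j, a j ∈ A j) → (∑ j, μ j (a j)) % q = r % q →
      ∑ j, c (a j) ≤ ∑ j, c (a₀ j) := by
    intro a ha hadm'
    rw [← hlin, ← hlin]
    by_cases hne : ∑ j, a j = ∑ j, a₀ j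
    · rw [hne]
    · rw [hc, hc]
      exact (hexp _ (hmem a ha hadm') hne).le
  obtain ⟨a, S, h1, h2, h3, h4, h5, h6, h7, h8⟩ := stub_markedSwitchNormalForm m q r hq A μ hμ c
    (fun j => hcΛ.mono fun x hx => hAΛ j x hx) a₀ ha₀A' hadm hmax
  refine ⟨w, c, a, S, hc, hcΛ, h1, h4, h5, h6, h7, h8, ?_⟩
  -- a maximiser's point is the vertex, by strict exposure
  by_contra hne
  have hne' : ∑ j, a j ≠ ∑ j, a₀ j := fun h => hne (by rw [h])
  have hlt : c (∑ j, a j) < c (∑ j, a₀ j) := by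
    rw [hc, hc]
    exact hexp _ (hmem a h1 h2) hne'
  rw [hlin, hlin, h3] at hlt
  exact lt_irrefl _ hlt

end MarkedDesignHullAux

/-- **THEOREM G′ (hull vertices of marked residue level sets of sumsets are polynomial, uniformly in the modulus),
registered stub `stub_markedDesignHull` of line `binomial-normal-form`.**  For letter sets `A j ⊆ ℕ²` (`j : Fin m`) of
size `≤ L`, `0/1` marks `μ j`, a modulus `q ≥ 1` and a residue `r`, the convex hull of
`X = {Σ_j a j : a j ∈ A j ∀ j, Σ_j μ j (a j) ≡ r (mod q)}` has at most `(4 ((m L)² + (m L)⁴) + 5) q²` extreme points.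
Proof: every extreme point is `Σ_j a j` for a special-form word `a` of a strictly exposing generic direction `w`
(`MarkedDesignHullAux.extremePoint_normalForm`); the datum `(sign vector of the |Λ|⁴ functionals
⟨w, (x - y) - (x' - y')⟩, n₀, n₁)` (letters `x, y, x', y'`, switch counts `n₀, n₁ < q`) determines the word
(`MarkedDesignHullAux.specs_transfer`, `MarkedDesignHullAux.word_eq`), so the extreme points inject into a set of size
`≤ (4 |Λ|⁴ + 5) q²` (`ResidueDesignHullAux.signvec_plane_count`), and `|Λ| ≤ Σ_j |A j| ≤ m L`. [folklore] -/
theorem stub_markedDesignHull (m q r : ℕ) (hq : 1 ≤ q) (A : Fin m → Finset (Fin 2 →₀ ℕ))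
    (μ : Fin m → (Fin 2 →₀ ℕ) → ℕ) (hμ : ∀ j a, μ j a ≤ 1) (L : ℕ) (hL : ∀ j, (A j).card ≤ L) :
    (Set.extremePoints ℝ (convexHull ℝ ((fun e : Fin 2 →₀ ℕ => fun i : Fin 2 => ((e i : ℕ) : ℝ)) ''
      (((Fintype.piFinset A).filter (fun a : Fin m → (Fin 2 →₀ ℕ) => (∑ j, μ j (a j)) % q = r % q)).image
        (fun a => ∑ j, a j) : Set (Fin 2 →₀ ℕ))))).ncard ≤
      (4 * (m * L * (m * L) + m * L * (m * L) * (m * L * (m * L))) + 5) * q ^ 2 := by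
  -- the letters
  obtain ⟨Λ, hΛ⟩ : ∃ Λ : Finset (Fin 2 →₀ ℕ), Λ = Finset.univ.biUnion A := ⟨_, rfl⟩
  have hAΛ : ∀ j, ∀ x ∈ A j, x ∈ Λ := fun j x hx => by
    rw [hΛ]
    exact Finset.mem_biUnion.2 ⟨j, Finset.mem_univ _, hx⟩
  have hℓ : Λ.card ≤ m * L := by
    rw [hΛ]
    refine Finset.card_biUnion_le.trans ?_
    calc ∑ j, (A j).card ≤ ∑ _j : Fin m, L := Finset.sum_le_sum fun j _ => hL j
      _ = m * L := by rw [Finset.sum_const, Finset.card_univ, Fintype.card_fin, smul_eq_mul]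
  -- the special-form word at every vertex
  have hex := fun e he => MarkedDesignHullAux.extremePoint_normalForm m q r hq A μ hμ Λ hAΛ e he
  choose! w c a S hc hinj h1 h4 h5 h6 h7 h8 heq using hex
  -- the `|Λ|⁴` linear functionals `w ↦ ⟨w, (x - y) - (x' - y')⟩`
  obtain ⟨κ, -⟩ : ∃ _κ : (Λ × Λ) × (Λ × Λ) ≃ Fin (Fintype.card ((Λ × Λ) × (Λ × Λ))), True :=
    ⟨Fintype.equivFin _, trivial⟩
  obtain ⟨u, hu⟩ : ∃ u : Fin (Fintype.card ((Λ × Λ) × (Λ × Λ))) → Fin 2 → ℝ,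
      ∀ (p : (Λ × Λ) × (Λ × Λ)) (i : Fin 2), u (κ p) i =
        ((p.1.1.1 i : ℕ) : ℝ) - ((p.1.2.1 i : ℕ) : ℝ) - (((p.2.1.1 i : ℕ) : ℝ) - ((p.2.2.1 i : ℕ) : ℝ)) :=
    ⟨fun k i => (((κ.symm k).1.1.1 i : ℕ) : ℝ) - (((κ.symm k).1.2.1 i : ℕ) : ℝ) -
        ((((κ.symm k).2.1.1 i : ℕ) : ℝ) - (((κ.symm k).2.2.1 i : ℕ) : ℝ)),
      fun p i => by simp only [Equiv.symm_apply_apply]⟩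
  -- the datum `(sign vector, n₀, n₁)` is injective on the vertices
  refine (Set.ncard_le_ncard_of_injOn
    (t := {v : Fin (Fintype.card ((Λ × Λ) × (Λ × Λ))) → SignType |
        ∃ w' : Fin 2 → ℝ, v = fun k => SignType.sign (∑ i, w' i * u k i)} ×ˢ
      ((↑(Finset.range q) : Set ℕ) ×ˢ (↑(Finset.range q) : Set ℕ)))
    (fun e => ((fun k => SignType.sign (∑ i, w e i * u k i)),
      (((S e).filter fun j => μ j (a e j) = 0).card, ((S e).filter fun j => μ j (a e j) = 1).card)))
    (fun e he => Set.mk_mem_prod ⟨w e, rfl⟩ (Set.mk_mem_prod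
      (Finset.mem_coe.2 (Finset.mem_range.2 (h6 e he))) (Finset.mem_coe.2 (Finset.mem_range.2 (h7 e he)))))
    ?_).trans ?_
  · intro e he e' he' hd
    simp only [Prod.mk.injEq] at hd
    obtain ⟨hsv, hn0, hn1⟩ := hd
    -- equal sign vectors: the two heights compare differences of letter heights alike
    have hcmp : ∀ x ∈ Λ, ∀ y ∈ Λ, ∀ x' ∈ Λ, ∀ y' ∈ Λ,
        SignType.sign (c e x - c e y - (c e x' - c e y')) =
          SignType.sign (c e' x - c e' y - (c e' x' - c e' y')) := by
      intro x hx y hy x' hx' y' hy'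
      have key := congr_fun hsv (κ ((⟨x, hx⟩, ⟨y, hy⟩), (⟨x', hx'⟩, ⟨y', hy'⟩)))
      simp only [hu, mul_sub, Finset.sum_sub_distrib] at key
      simpa only [hc e he, hc e' he'] using key
    obtain ⟨h4t, h5t, h8t⟩ := MarkedDesignHullAux.specs_transfer A Λ hAΛ μ (c e) (c e') hcmp (a e') (S e')
      (h1 e' he') (h4 e' he') (h5 e' he') (h8 e' he')
    have hae := MarkedDesignHullAux.word_eq A μ hμ (c e) (fun j => (hinj e he).mono fun x hx => hAΛ j x hx)
      (a e) (a e') (S e) (S e') (h1 e he) (h4 e he) (h5 e he) (h8 e he) (h1 e' he') h4t h5t h8t hn0 hn1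
    rw [heq e he, heq e' he', hae]
  -- count
  · rw [Set.ncard_prod, Set.ncard_prod, Set.ncard_coe_finset, Finset.card_range, sq]
    refine Nat.mul_le_mul_right _ ((ResidueDesignHullAux.signvec_plane_count _ u).trans
      (Nat.add_le_add_right (Nat.mul_le_mul_left 4 ?_) 5))
    calc Fintype.card ((Λ × Λ) × (Λ × Λ)) = Λ.card * Λ.card * (Λ.card * Λ.card) := by
          simp only [Fintype.card_prod, Fintype.card_coe]
      _ ≤ m * L * (m * L) * (m * L * (m * L)) := Nat.mul_le_mul (Nat.mul_le_mul hℓ hℓ) (Nat.mul_le_mul hℓ hℓ)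
      _ ≤ _ := Nat.le_add_left _ _

end Summit.ValiantsHypothesis.ValiantsHypothesis.Theorems.NewtonUnitEquationsNewtonTauWeak

end
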